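import Summits.Ventures.PercRepro.C026SeriesParallel

/-!
# C-026 at every `p` on the theta-hub graph — a 10-edge instance of the series–parallel theorem (p6, gen 10)

`thetaHub`: marks `0, 1, 2`; two hubs `3, 4`, each joined to all three marks; the hubs joined by TWO
internally disjoint paths of length two through the midpoints `5` and `6`.  The bridge `{3, 4, 5, 6}`
contains the cycle `3–5–4–6–3`, so the graph is neither acyclic nor hub-pair (the hub `3` has the two
non-mark neighbours `5` and `6`), and no theorem of the lane applies to it directly.  Two series steps at
`5` and `6` and one parallel step reduce it to the hub-pair graph with the single hub edge `3–4`
(`thetaHub_reduces`); the dead edges `7, 8, 9` are deleted by the endpoint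
(`C026At_of_reduces_hubPair`), so C-026 holds for `thetaHub` at every edge weight
(`C026At_thetaHub`).  The series / parallel conditions are decided on the finite types.
-/

namespace PercRepro

namespace MultiGraph

/-- The theta-hub graph: edges `0: 0–3, 1: 1–3, 2: 2–3, 3: 0–4, 4: 1–4, 5: 2–4, 6: 3–5, 7: 5–4,
8: 3–6, 9: 6–4`. -/
def thetaHub : MultiGraph (Fin 7) (Fin 10) where
  fst := ![0, 1, 2, 0, 1, 2, 3, 5, 3, 6]
  snd := ![3, 3, 3, 4, 4, 4, 5, 4, 6, 4]

/-- After the two series steps: the edges `6` and `8` re-attached to `3–4`. -/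
def thetaHub.reduced : MultiGraph (Fin 7) (Fin 10) :=
  (thetaHub.seriesGraph 6 3 4).seriesGraph 8 3 4

/-- The weight after the chain (series at `5`, series at `6`, parallel `6 ∥ 8`). -/
noncomputable def thetaHub.reducedWeight (p : Fin 10 → ℝ) : Fin 10 → ℝ :=
  parWeight (serWeight (serWeight p 6 7) 8 9) 6 8

/-- `IsSeries` is decidable on finite types. -/
instance decidableIsSeriesFin {V E : Type} [DecidableEq V] [DecidableEq E] [Fintype E]
    (G : MultiGraph V E) (e₁ e₂ : E) (x y z : V) : Decidable (G.IsSeries e₁ e₂ x y z) :=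
  decidable_of_iff (e₁ ≠ e₂ ∧ ((G.fst e₁ = y ∧ G.snd e₁ = x) ∨ (G.fst e₁ = x ∧ G.snd e₁ = y)) ∧
      ((G.fst e₂ = x ∧ G.snd e₂ = z) ∨ (G.fst e₂ = z ∧ G.snd e₂ = x)) ∧ y ≠ x ∧ z ≠ x ∧
      ∀ e, G.fst e = x ∨ G.snd e = x → e = e₁ ∨ e = e₂)
    ⟨fun ⟨h1, h2, h3, h4, h5, h6⟩ => ⟨h1, h2, h3, h4, h5, h6⟩,
     fun ⟨h1, h2, h3, h4, h5, h6⟩ => ⟨h1, h2, h3, h4, h5, h6⟩⟩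

/-- `Parallel` is decidable. -/
instance decidableParallelFin {V E : Type} [DecidableEq V] (G : MultiGraph V E) (e₁ e₂ : E) :
    Decidable (G.Parallel e₁ e₂) :=
  decidable_of_iff ((G.fst e₁ = G.fst e₂ ∧ G.snd e₁ = G.snd e₂) ∨
    (G.fst e₁ = G.snd e₂ ∧ G.snd e₁ = G.fst e₂)) Iff.rfl

/-- The chain: series at `5`, series at `6`, parallel `6 ∥ 8`. -/
theorem thetaHub_reduces (p : Fin 10 → ℝ) :
    Reduces3 (0 : Fin 7) 1 2 (thetaHub, p) (thetaHub.reduced, thetaHub.reducedWeight p) := by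
  unfold Reduces3
  refine Relation.ReflTransGen.head
    (SPStep3.series (e₁ := 6) (e₂ := 7) (x := 5) (y := 3) (z := 4) (by decide) (by decide)) ?_
  refine Relation.ReflTransGen.head
    (SPStep3.series (e₁ := 8) (e₂ := 9) (x := 6) (y := 3) (z := 4) (by decide) (by decide)) ?_
  refine Relation.ReflTransGen.head
    (SPStep3.parallel (e₁ := 6) (e₂ := 8) (by decide) (by decide)) ?_
  exact Relation.ReflTransGen.refl

/-- After the chain the edges `7, 8, 9` are dead. -/
theorem thetaHub.reducedWeight_dead (p : Fin 10 → ℝ) :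
    ∀ e : Fin 10, 7 ≤ e.val → thetaHub.reducedWeight p e = 0 := by
  intro e he
  unfold thetaHub.reducedWeight parWeight serWeight
  fin_cases e <;> simp at he ⊢

/-- The live edges of the reduced weight are among `0, …, 6`. -/
theorem thetaHub.liveConfig_le (p : Fin 10 → ℝ) :
    liveConfig (thetaHub.reducedWeight p) ≤ fun e : Fin 10 => decide (e.val ≤ 6) := by
  intro e
  by_cases he : e.val ≤ 6
  · simp [he]
  · have hd := thetaHub.reducedWeight_dead p e (by omega)
    simp [liveConfig, hd]

/-- On the edges `0, …, 6` the reduced graph is hub-pair: the only edge between two non-marks is `6`,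
joining `3` and `4`. -/
theorem thetaHub.reduced_isHubPairOn :
    thetaHub.reduced.IsHubPairOn (fun e : Fin 10 => decide (e.val ≤ 6)) 0 1 2 := by
  refine isHubPairOn_of_pair _ _ 0 1 2 3 4 ?_
  decide

/-- **C-026 for the theta-hub graph at every `p`**: ten edges, a cycle inside the bridge — neither
acyclic nor hub-pair — reduced by two series steps and one parallel step to a hub-pair graph. -/
theorem C026At_thetaHub (p : Fin 10 → ℝ) (hp : IsProb p) : thetaHub.C026At p 0 1 2 :=
  C026At_of_reduces_hubPair hp (thetaHub_reduces p)
    (thetaHub.reduced_isHubPairOn.mono (thetaHub.liveConfig_le p))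

end MultiGraph

end PercRepro
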